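import Summits.BirchSwinnertonDyer.BirchSwinnertonDyer.Theses.TwistFamilyManinDescent

/-!
# Sketch — crux idea `tame-torsor-descent` REVISED (g25: TTD-SS5) for
`TwistFamilyManinDescent.EisensteinAdditiveManinResidual` (stmt-BirchSwinnertonDyer-25138)

g25 ran the card's falsifier F1-min: the push-out mechanism is DEAD on every row where `E` is
ordinary over the tame field (all crux rows with `p ≥ 7`) and survives only on the supersingular
tame rows `p = 5`, `e₅ = 3` (Kodaira IV, IV*).  First lemma of the surviving line = the transfer
target restricted accordingly: for the lattice-optimal curve, `5² ∣ N`, twist-minimal additive at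
`5` with semistability defect `3`, `5 ∤ c`.  (Reducibility is not used by the mechanism; the
reducible rows are K15b's `p = 5` half of the crux.)
-/

namespace Summit.BirchSwinnertonDyer.BirchSwinnertonDyer.Cruxes.EisensteinAdditiveManinResidual.TameTorsorDescent

open Literature.NumberTheory.EllipticCurves.ModularForms WeierstrassCurve

/-- The semistability defect `e_p = 12 / gcd(12, v_p(Δ_min))` of a globally minimal model. -/
noncomputable def semistabilityDefect (W : WeierstrassCurve ℚ) [W.IsElliptic] [W.IsGloballyMinimal]
    (p : ℕ) : ℕ :=
  12 / Nat.gcd 12 (padicValInt p W.minimalDiscriminantInt)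

/-- FIRST LEMMA of TTD-SS5 (`[crux-idea tame-torsor-descent, revised g25]`): at `p = 5`, on the
supersingular tame rows `e₅ = 3` (types IV, IV*; `5 ≡ 2 (mod 3)` so `j̃ = 0` is supersingular),
the Manin constant of the lattice-optimal curve is a `5`-unit.  Mechanism: receivers lemma REC
(no locally-split crossed receiver of `E[5]/C_can` in `ker φ / (ker φ)^{L-ss}`) + sufficiency ⇒ a
homomorphism from the finite flat kernel `𝒦` into the Néron model of `ker φ` over
`O_L`, `L = ℚ₅^{nr}(5^{1/3})` ⇒ fppf push-out, `H¹(O_L, 𝒜_L) = 0` ⇒ `J₀(N)(L) ↠ E(L)` ⇒ trace ⇒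
Néron-quotient dichotomy ⇒ `Lie φ` onto over `ℤ₅` ⇒ ČNS ⇒ `5 ∤ c`. -/
def SupersingularTameStrongManinUnit : Prop :=
  ∀ (W : WeierstrassCurve ℚ) [W.IsElliptic] [W.IsGloballyMinimal] {N : ℕ} [NeZero N]
    (D : ModularParametrizationData W N),
    5 ^ 2 ∣ N →
    ¬ ((W.quadraticTwist ((5 : ℤ) : ℚ)).HasGoodReductionAt
          ((Rat.HeightOneSpectrum.primesEquiv (R := ℤ)).symm ⟨5, Nat.prime_five⟩) ∨
       (W.quadraticTwist ((5 : ℤ) : ℚ)).HasMultiplicativeReductionAt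
          ((Rat.HeightOneSpectrum.primesEquiv (R := ℤ)).symm ⟨5, Nat.prime_five⟩)) →
    semistabilityDefect W 5 = 3 →
    (∀ z ∈ D.L.lattice, ∃ w ∈ periodLattice D.f, z = D.c * w) →
    ¬ (5 : ℤ) ∣ D.maninConstant

/-- Sanity: `(-1)^(5/2) * 5 = 5`, so the twist above is the crux's `χ_{p*}`-twist at `p = 5`. -/
example : ((-1 : ℤ) ^ (5 / 2) * 5 : ℤ) = 5 := by norm_num

end Summit.BirchSwinnertonDyer.BirchSwinnertonDyer.Cruxes.EisensteinAdditiveManinResidual.TameTorsorDescent
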